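import Summits.BirchSwinnertonDyer.BirchSwinnertonDyer.Theorems.SchneiderFreeAdditiveX3AnomalousTwistLocalData
import Summits.BirchSwinnertonDyer.BirchSwinnertonDyer.Theorems.EisensteinPrimesSplitMultLocalHZero
import HarnessLib

/-!
# Route `SchneiderFreeAdditiveX3` (K1 door), crux r3 `GordTwoBranchIMC` (stmt-BirchSwinnertonDyer-19177): THE LOCAL `H⁰` PACKAGE AT
# `v̄` of the V21 index road FOR THE ANOMALOUS `(−3)`-TWIST, orientation `(ω, 𝟙)` — and the orientation UPGRADE «some `τ ∈ D_v̄` has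
# `θsub(τ) ≠ 1`» ⟹ «`θsub` is RAMIFIED at `v̄` and `D_v̄` is trivial on the quotient»

Cell `bsd-schneider-ideate`, seat `bsd-schneider-door-c5` (prover, generation 31; assembly layer; `--supports` 19177, helper).
PARTITION: board row B6 ∩ X3 ∩ sst-twist, `r = 1` — the 1 725 ANOMALOUS pairs of the (G-ord, `e = 2`) half at `p = 3` (of 2 411).
bears_on: K1-door (items 18971/18972 retired → 19177 r3).  FILE 3 of the port of cell `bsd-eis`'s V21 INDEX ROAD (Keller–Yin
arXiv:2402.12781 Thm. 1.4.1 (iii)) to the door's ANOMALOUS TWIN `W = C • V^{(−3)}` (FINDING-door-c5-g28 §5b `stub_λW`) = the door analogue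
of x2-p2 g10's `EisensteinPrimesSplitMultLocalHZero`, AT x1's EXACT TYPES so that the x1 producers downstream run verbatim:

* §1 `trivQuot_and_exists_inertia_smul_ne_of_exists_unitChar_ne_one` — for a `Γ_K`-stable line `Φ ≤ W_K[3]` (`#Φ = 3`) embedded
  equivariantly in `(F/𝒪)(θsub)`: IF some `τ ∈ D_v̄` has `θsub(τ) ≠ 1` THEN `D_v̄` is TRIVIAL on `W_K[3]/Φ` AND some `g ∈ I_v̄` MOVES `Φ`
  (FILE 2's dichotomy `AnomalousTwistLocalData.localData_of_anomalousTwist`, the branch «`D_v̄` fixes `Φ`» excluded by x2's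
  `SplitMultLocalHZero.exists_smul_ne_of_exists_unitChar_ne_one`); `exists_mem_inertia_unitChar_ne_one_of_exists_mem_decomp` — the
  ORIENTATION UPGRADE: `θsub` is then RAMIFIED at `v̄` (the `hramI` binder of x2's `…SplitMultLambdaLEOffP`, here DERIVED, not assumed);
* §2 `forall_inf_decomp_smul_quot_eq_self_of_anomalousTwist` (`htrivD`); `hN₁D` is x2's reduction-free
  `SplitMultLocalHZero.sub_eq_zero_of_forall_inf_decomp_smul_eq_of_split` BY NAME; Fin_v (`E(K_{∞,v̄})[3^∞]` finite) is CARRIED as the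
  hypothesis `hfinED` — on the door's cells it is the CLOSED crux r5 `LocalTowerTorsionFiniteX3` (19546, `localTowerTorsionFiniteX3_proof`),
  discharged in the door-currency wrapper, not here;
* §3 `hZero_package_of_anomalousTwist` — the thirteen «global `H⁰`» / «local `H⁰` at `H ⊓ D_v̄`» conjuncts of x1's `stub_indexInputs` in x1's
  ORDER AND TYPES (ten reduction-free ones by x1's `ResidualIndexHZero.*`), and `exists_stableLine_hZero_package_of_anomalousTwist`.

Binders: `V/ℚ` globally minimal good ordinary at `p = 3` with `3 ∣ a₃(V) − 1`, `W = C • V^{(p*)}` (globally minimal on the door), `K`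
imaginary quadratic with `3 = v v̄` split (x1's convention `v`, `vbar`, `vbar ≠ v`), `W(K)[3] = 0`, `κ` a `ℤ₃`-extension, `(θsub, θquot)` a
residual pair of `W_K[3]` with `θsub` NON-TRIVIAL ON `D_v̄`.

HONEST FRAMING: helper theorems only (no definition, no named fact, no `sorry`); UNCONDITIONAL; closes no stub; nothing analytic; no item
closed; BSD proved for no curve; «closes rung: none».  References: Keller–Yin arXiv:2402.12781v2 §1.3 Prop. 1.3.3 (iii), §1.4 Thm. 1.4.1
and Cases I–III [KellerYin2024]; Greenberg LNM 1716 §1 p. 62, §4 p. 109 [GreenbergLNM1716]; x1 `ResidualIndexHZero`, x2 `SplitMultLocalHZero`.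
-/

set_option autoImplicit false
-- the route's Theorems namespace repeats the summit name by design (D-0017 nested layout)
set_option linter.dupNamespace false

noncomputable section

open scoped Classical

namespace Summit.BirchSwinnertonDyer.BirchSwinnertonDyer.Theorems.SchneiderFreeAdditiveX3.AnomalousTwistLocalHZero

open NumberField IsDedekindDomain Field WeierstrassCurve
  Literature.NumberTheory.EllipticCurves Literature.NumberTheory.EllipticCurves.GreenbergSelmer
  Literature.NumberTheory.EllipticCurves.Rank1Residual Literature.NumberTheory.GaloisRepresentations
  Literature.NumberTheory.EllipticCurves.KellerYin2024 Literature.NumberTheory.IwasawaTheory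
  Summit.BirchSwinnertonDyer.Rank1Residual.X2.ResidualDevissageModules
  Summit.BirchSwinnertonDyer.BirchSwinnertonDyer.Theorems
  Summit.BirchSwinnertonDyer.BirchSwinnertonDyer.Theorems.CharResidualSelmerCount
  Summit.BirchSwinnertonDyer.BirchSwinnertonDyer.Theorems.SchneiderFreeAdditiveX3.AnomalousTwistLocalData

/-! ## §1. Orientation `(ω, 𝟙)`: `θsub` non-trivial on `D_v̄` forces `D_v̄` trivial on `W_K[3]/Φ` and `θsub` RAMIFIED at `v̄` -/

section Orientation

variable {p : ℕ} [hp : Fact p.Prime] {V : WeierstrassCurve ℚ} [V.IsElliptic] [V.IsGloballyMinimal]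
  (W : WeierstrassCurve ℚ) [W.IsElliptic]
  (K : Type) [Field K] [NumberField K] (vbar : HeightOneSpectrum (𝓞 K))

/-- **Orientation `(ω, 𝟙)` for the anomalous `(−3)`-twist.** `V/ℚ` globally minimal good ordinary at `p = 3` with `3 ∣ a₃(V) − 1`,
`W = C • V^{(p*)}`, `K` imaginary quadratic with `3 = v v̄`; `Φ` a `Γ_K`-stable line of `W_K[3]` (`#Φ = 3`) embedded equivariantly in
`(F/𝒪)(θsub)` (`θsub^{p−1} = 1`).  IF some `τ ∈ D_v̄` has `θsub(τ) ≠ 1`, THEN `#(W_K[3]/Φ) = 3`, `D_v̄` acts TRIVIALLY on `W_K[3]/Φ` and some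
INERTIA element of `v̄` moves `Φ` — FILE 2's dichotomy with the branch «`D_v̄` fixes `Φ` pointwise» excluded by x2's mover.
[cite: KellerYin2024, §1.3 Prop. 1.3.1, §1.4 (arXiv:2402.12781v2 TeX L1066–1083)] [cite: SilvermanAEC2009, X.5 Cor. 5.4] -/
theorem trivQuot_and_exists_inertia_smul_ne_of_exists_unitChar_ne_one
    (hp3 : p = 3) (hV : GoodOrd V p) (ha : (p : ℤ) ∣ V.frobeniusTrace p - 1)
    (C : VariableChange ℚ) (hC : C • V.quadraticTwist ((-1 : ℚ) ^ (p / 2) * p) = W)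
    (hK : IsImaginaryQuadratic K) {v : HeightOneSpectrum (𝓞 K)} (hpvK : ((p : ℕ) : 𝓞 K) ∈ v.asIdeal)
    (hvbar : ((p : ℕ) : 𝓞 K) ∈ vbar.asIdeal) (hne : vbar ≠ v)
    (θsub : FramedGaloisRep K (padicCoeffIntegers (∅ : Set (PadicAlgCl p))) 1)
    (hθsub : ∀ σ : absoluteGaloisGroup K, θsub σ ^ (p - 1) = 1)
    (Φ : StableSubgroup (absoluteGaloisGroup K) ↥((W.baseChange K).geomTorsion (p : ℤ)))
    (hSub : Nat.card Φ.Sub = p) (j₁ : Φ.Sub →+ charModule (∅ : Set (PadicAlgCl p)) θsub)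
    (hj₁ : ∀ (g : absoluteGaloisGroup K) (a : Φ.Sub), j₁ (g • a) = g • j₁ a) (hj₁inj : Function.Injective j₁)
    (hram : ∃ τ ∈ decomp vbar, unitChar θsub τ ≠ 1) :
    Nat.card Φ.Quot = p ∧ (∀ g ∈ decomp vbar, ∀ y : Φ.Quot, g • y = y) ∧
      (∃ g ∈ inertia vbar, ∃ x : Φ.Sub, g • x ≠ x) := by
  obtain ⟨hQuot, hcases⟩ := localData_of_anomalousTwist W K vbar hp3 hV ha C hC hK hpvK hvbar hne Φ hSub
  refine ⟨hQuot, ?_⟩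
  rcases hcases with ⟨hfix, -⟩ | ⟨hmov, hquot⟩
  · exfalso
    obtain ⟨τ, hτ, x, hx⟩ :=
      SplitMultLocalHZero.exists_smul_ne_of_exists_unitChar_ne_one W K vbar θsub hθsub Φ hSub j₁ hj₁ hj₁inj hram
    exact hx (hfix τ hτ x)
  · exact ⟨hquot, hmov⟩

/-- **THE ORIENTATION UPGRADE: `θsub` is RAMIFIED at `v̄`** (some `τ ∈ I_v̄` has `unitChar θsub τ ≠ 1`) as soon as some `τ ∈ D_v̄` has
`θsub(τ) ≠ 1` — the inertia element moving `Φ` of §1 does not act trivially on `(F/𝒪)(θsub) ⊇ j₁(Φ)`.  This is the binder `hramI` of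
x2's `SplitMultLambdaLEOffP.lambdaInvariant_add_le_of_split_offP` (there ASSUMED; here DERIVED for the door).
[cite: KellerYin2024, Prop. 1.3.1 and §1.4 display (char to f) (arXiv:2402.12781v2 TeX L877, L1063–1087)] [cite: Serre1972, §1.11 Prop. 12] -/
theorem exists_mem_inertia_unitChar_ne_one_of_exists_mem_decomp
    (hp3 : p = 3) (hV : GoodOrd V p) (ha : (p : ℤ) ∣ V.frobeniusTrace p - 1)
    (C : VariableChange ℚ) (hC : C • V.quadraticTwist ((-1 : ℚ) ^ (p / 2) * p) = W)
    (hK : IsImaginaryQuadratic K) {v : HeightOneSpectrum (𝓞 K)} (hpvK : ((p : ℕ) : 𝓞 K) ∈ v.asIdeal)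
    (hvbar : ((p : ℕ) : 𝓞 K) ∈ vbar.asIdeal) (hne : vbar ≠ v)
    (θsub : FramedGaloisRep K (padicCoeffIntegers (∅ : Set (PadicAlgCl p))) 1)
    (hθsub : ∀ σ : absoluteGaloisGroup K, θsub σ ^ (p - 1) = 1)
    (Φ : StableSubgroup (absoluteGaloisGroup K) ↥((W.baseChange K).geomTorsion (p : ℤ)))
    (hSub : Nat.card Φ.Sub = p) (j₁ : Φ.Sub →+ charModule (∅ : Set (PadicAlgCl p)) θsub)
    (hj₁ : ∀ (g : absoluteGaloisGroup K) (a : Φ.Sub), j₁ (g • a) = g • j₁ a) (hj₁inj : Function.Injective j₁)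
    (hram : ∃ τ ∈ decomp vbar, unitChar θsub τ ≠ 1) :
    ∃ τ ∈ inertia vbar, unitChar θsub τ ≠ 1 := by
  obtain ⟨-, -, g, hg, x, hx⟩ := trivQuot_and_exists_inertia_smul_ne_of_exists_unitChar_ne_one W K vbar hp3 hV ha C hC hK
    hpvK hvbar hne θsub hθsub Φ hSub j₁ hj₁ hj₁inj hram
  refine ⟨g, hg, fun h1 ↦ hx ?_⟩
  apply hj₁inj
  rw [hj₁]
  obtain ⟨z, hz⟩ := (charModuleEquiv θsub).symm.surjective (j₁ x)
  rw [← hz, CharResidualSelmerFinite.galois_smul_charModuleEquiv_symm, h1, Units.val_one, one_smul]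

end Orientation

/-! ## §2. The local `H⁰` conjunct `htrivD` at `ker κ ⊓ D_v̄` -/

section Local

variable {p : ℕ} [hp : Fact p.Prime] {V : WeierstrassCurve ℚ} [V.IsElliptic] [V.IsGloballyMinimal]
  (W : WeierstrassCurve ℚ) [W.IsElliptic]
  (K : Type) [Field K] [NumberField K] (vbar : HeightOneSpectrum (𝓞 K)) (κ : ZpExtension K p)

/-- **`htrivD` for the anomalous `(−3)`-twist, orientation `(ω, 𝟙)`**: `ker κ ⊓ D_v̄` (indeed all of `D_v̄`) acts trivially on `W_K[3]/Φ` —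
V21 step (5): `N_1^{G_j} = N_1 = 𝔽`. For EVERY `ℤ₃`-extension `κ`. [cite: KellerYin2024, §1.4 (arXiv:2402.12781v2 TeX L1066–1083, L1240–1260)] -/
theorem forall_inf_decomp_smul_quot_eq_self_of_anomalousTwist
    (hp3 : p = 3) (hV : GoodOrd V p) (ha : (p : ℤ) ∣ V.frobeniusTrace p - 1)
    (C : VariableChange ℚ) (hC : C • V.quadraticTwist ((-1 : ℚ) ^ (p / 2) * p) = W)
    (hK : IsImaginaryQuadratic K) {v : HeightOneSpectrum (𝓞 K)} (hpvK : ((p : ℕ) : 𝓞 K) ∈ v.asIdeal)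
    (hvbar : ((p : ℕ) : 𝓞 K) ∈ vbar.asIdeal) (hne : vbar ≠ v)
    (θsub : FramedGaloisRep K (padicCoeffIntegers (∅ : Set (PadicAlgCl p))) 1)
    (hθsub : ∀ σ : absoluteGaloisGroup K, θsub σ ^ (p - 1) = 1)
    (Φ : StableSubgroup (absoluteGaloisGroup K) ↥((W.baseChange K).geomTorsion (p : ℤ)))
    (hSub : Nat.card Φ.Sub = p) (j₁ : Φ.Sub →+ charModule (∅ : Set (PadicAlgCl p)) θsub)
    (hj₁ : ∀ (g : absoluteGaloisGroup K) (a : Φ.Sub), j₁ (g • a) = g • j₁ a) (hj₁inj : Function.Injective j₁)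
    (hram : ∃ τ ∈ decomp vbar, unitChar θsub τ ≠ 1) :
    ∀ (g : ↥(κ.kerSubgroup ⊓ decomp vbar)) (n : Φ.Quot), g • n = n := fun g n ↦
  (trivQuot_and_exists_inertia_smul_ne_of_exists_unitChar_ne_one W K vbar hp3 hV ha C hC hK hpvK hvbar hne θsub hθsub Φ hSub j₁
    hj₁ hj₁inj hram).2.1 _ (Subgroup.mem_inf.mp g.2).2 n

end Local

/-! ## §3. The thirteen-conjunct `H⁰` package of the index road for the anomalous `(−3)`-twist -/

section Package

/-- **THE `H⁰` PACKAGE OF THE V21 INDEX ROAD FOR THE ANOMALOUS `(−3)`-TWIST, orientation `(ω, 𝟙)`** — the conjuncts «global `H⁰`» and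
«local `H⁰` at `H ⊓ D_v̄`» of x1's `stub_indexInputs` in x1's ORDER AND TYPES (cf. `ResidualIndexHZero.hZero_package`,
`SplitMultLocalHZero.hZero_package_of_split`): on the binders `V` good ordinary anomalous at `p = 3`, `W = C • V^{(p*)}`, `K` imaginary
quadratic with `3 = v v̄`, `W(K)[3] = 0`, `κ` a `ℤ₃`-extension, `(θsub, θquot)` a residual pair of `W_K[3]`, for ANY `Γ_K`-stable line `Φ` of
`W_K[3]` (`#Φ = #(W_K[3]/Φ) = 3`) with equivariant embeddings `j₁ : Φ ↪ (F/𝒪)(θsub)`, `j₃ : W_K[3]/Φ ↪ (F/𝒪)(θquot)`, GIVEN a `τ ∈ D_v̄`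
with `θsub(τ) ≠ 1` (orientation) and GIVEN Fin_v `hfinED` (`W_K[3^∞]^{ker κ ⊓ D_v̄}` finite — the door's closed crux r5): (1)–(3) the
`ker κ`-invariants of `(F/𝒪)(θsub)`, `W_K[3^∞]`, `(F/𝒪)(θquot)` are `3`-divisible in themselves; (4) `W_K[3]^{ker κ} = 0`; (5)–(6)
`(W_K[3]/Φ)^{ker κ}` finite of order `3^ε`, `ε = [θquot = 𝟙]`; (7) `Φ^{ker κ ⊓ D_v̄} = 0`; (8) `ker κ ⊓ D_v̄` trivial on `W_K[3]/Φ`; (9)–(10)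
`W_K[3]/Φ` finite of order `3`; (11) = `hfinED`; (12)–(13) the `ker κ ⊓ D_v̄`-invariants of `(F/𝒪)(θsub)`, `(F/𝒪)(θquot)` divisible.
[cite: KellerYin2024, §1.3 Prop. 1.3.3 (iii), §1.4 Thm. 1.4.1 and Cases I–III (arXiv:2402.12781v2 TeX L948–957, L1066–1098, L1178–1330)]
[cite: GreenbergLNM1716, §1 p. 62, §4 p. 109] -/
theorem hZero_package_of_anomalousTwist {V : WeierstrassCurve ℚ} [V.IsElliptic] [V.IsGloballyMinimal]
    (W : WeierstrassCurve ℚ) [W.IsElliptic] (p : ℕ) [Fact p.Prime]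
    (hp3 : p = 3) (hV : GoodOrd V p) (ha : (p : ℤ) ∣ V.frobeniusTrace p - 1)
    (C : VariableChange ℚ) (hC : C • V.quadraticTwist ((-1 : ℚ) ^ (p / 2) * p) = W)
    (K : Type) [Field K] [NumberField K] (hK : IsImaginaryQuadratic K)
    (htor : ∀ Q : (W.baseChange K).toAffine.Point, p • Q = 0 → Q = 0)
    {v : HeightOneSpectrum (𝓞 K)} (vbar : HeightOneSpectrum (𝓞 K)) (hpvK : ((p : ℕ) : 𝓞 K) ∈ v.asIdeal)
    (hvbar : ((p : ℕ) : 𝓞 K) ∈ vbar.asIdeal) (hne : vbar ≠ v)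
    (κ : ZpExtension K p)
    (θsub θquot : FramedGaloisRep K (padicCoeffIntegers (∅ : Set (PadicAlgCl p))) 1)
    (hpair : IsResidualPairOver (W.baseChange K) p θsub θquot)
    (hram : ∃ τ ∈ decomp vbar, unitChar θsub τ ≠ 1)
    (hfinED : Finite {x : ↥((W.baseChange K).geomPrimaryTorsion p) // ∀ g : ↥(κ.kerSubgroup ⊓ decomp vbar), g • x = x})
    (Φ : StableSubgroup (absoluteGaloisGroup K) ↥((W.baseChange K).geomTorsion (p : ℤ)))
    (hSub : Nat.card Φ.Sub = p) (hQuot : Nat.card Φ.Quot = p)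
    (j₁ : Φ.Sub →+ charModule ∅ θsub)
    (hj₁ : ∀ (g : absoluteGaloisGroup K) (a : Φ.Sub), j₁ (g • a) = g • j₁ a) (hj₁inj : Function.Injective j₁)
    (j₃ : Φ.Quot →+ charModule ∅ θquot)
    (hj₃ : ∀ (g : absoluteGaloisGroup K) (a : Φ.Quot), j₃ (g • a) = g • j₃ a) (hj₃inj : Function.Injective j₃) :
    -- global H⁰
    (∀ x : (charModule ∅ θsub), (∀ g : ↥κ.kerSubgroup, g • x = x) → ∃ x' : (charModule ∅ θsub), (∀ g : ↥κ.kerSubgroup, g • x' = x') ∧ p • x' = x) ∧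
    (∀ x : ↥((W.baseChange K).geomPrimaryTorsion p), (∀ g : ↥κ.kerSubgroup, g • x = x) → ∃ x' : ↥((W.baseChange K).geomPrimaryTorsion p), (∀ g : ↥κ.kerSubgroup, g • x' = x') ∧ p • x' = x) ∧
    (∀ x : (charModule ∅ θquot), (∀ g : ↥κ.kerSubgroup, g • x = x) → ∃ x' : (charModule ∅ θquot), (∀ g : ↥κ.kerSubgroup, g • x' = x') ∧ p • x' = x) ∧
    (∀ n : ↥((W.baseChange K).geomTorsion (p : ℤ)), (∀ g : ↥κ.kerSubgroup, g • n = n) → n = 0) ∧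
    Finite {n : Φ.Quot // ∀ g : ↥κ.kerSubgroup, g • n = n} ∧
    Nat.card {n : Φ.Quot // ∀ g : ↥κ.kerSubgroup, g • n = n} = p ^ (if ∀ σ : absoluteGaloisGroup K, θquot σ = 1 then 1 else 0) ∧
    -- local H⁰ at `H ⊓ D_v̄`
    (∀ n : Φ.Sub, (∀ g : ↥(κ.kerSubgroup ⊓ decomp vbar), g • n = n) → n = 0) ∧
    (∀ (g : ↥(κ.kerSubgroup ⊓ decomp vbar)) (n : Φ.Quot), g • n = n) ∧
    Finite Φ.Quot ∧ Nat.card Φ.Quot = p ∧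
    Finite {x : ↥((W.baseChange K).geomPrimaryTorsion p) // ∀ g : ↥(κ.kerSubgroup ⊓ decomp vbar), g • x = x} ∧
    (∀ x : (charModule ∅ θsub), (∀ g : ↥(κ.kerSubgroup ⊓ decomp vbar), g • x = x) → ∃ x' : (charModule ∅ θsub), (∀ g : ↥(κ.kerSubgroup ⊓ decomp vbar), g • x' = x') ∧ p • x' = x) ∧
    (∀ x : (charModule ∅ θquot), (∀ g : ↥(κ.kerSubgroup ⊓ decomp vbar), g • x = x) → ∃ x' : (charModule ∅ θquot), (∀ g : ↥(κ.kerSubgroup ⊓ decomp vbar), g • x' = x') ∧ p • x' = x) := by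
  have hpr : p.Prime := Fact.out
  have hθsub : ∀ σ : absoluteGaloisGroup K, θsub σ ^ (p - 1) = 1 := fun σ ↦ (hpair.pow_sub_one σ).1
  have hθquot : ∀ σ : absoluteGaloisGroup K, θquot σ ^ (p - 1) = 1 := fun σ ↦ (hpair.pow_sub_one σ).2
  haveI : Finite Φ.Quot := Nat.finite_of_card_ne_zero (by rw [hQuot]; exact hpr.ne_zero)
  exact ⟨ResidualIndexHZero.charModule_subgroup_invariants_divisible θsub hθsub κ.kerSubgroup,
    ResidualIndexHZero.geomPrimaryTorsion_kerSubgroup_invariants_divisible κ (W.baseChange K) htor,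
    ResidualIndexHZero.charModule_subgroup_invariants_divisible θquot hθquot κ.kerSubgroup,
    ResidualIndexHZero.geomTorsion_eq_zero_of_forall_kerSubgroup_smul_eq κ (W.baseChange K) htor,
    inferInstance,
    ResidualIndexHZero.natCard_fixed_kerSubgroup_eq θquot κ hθquot hQuot j₃ hj₃ hj₃inj,
    SplitMultLocalHZero.sub_eq_zero_of_forall_inf_decomp_smul_eq_of_split W K vbar κ θsub hθsub Φ hSub j₁ hj₁ hj₁inj hram,
    forall_inf_decomp_smul_quot_eq_self_of_anomalousTwist W K vbar κ hp3 hV ha C hC hK hpvK hvbar hne θsub hθsub Φ hSub j₁ hj₁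
      hj₁inj hram,
    inferInstance, hQuot, hfinED,
    ResidualIndexHZero.charModule_subgroup_invariants_divisible θsub hθsub _,
    ResidualIndexHZero.charModule_subgroup_invariants_divisible θquot hθquot _⟩

/-- **The package from the residual pair alone, anomalous `(−3)`-twist, orientation `(ω, 𝟙)`**: `IsResidualPairOver` yields the stable line `Φ`
with `#Φ = #(W_K[3]/Φ) = 3` and both Kummer embeddings (`ResidualPairStableLine.exists_stableLine_of_isResidualPairOver`), for which the thirteen
`H⁰` conjuncts hold (the door twin of x1's `ResidualIndexHZero.exists_stableLine_hZero_package` / x2's `…_of_split`).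
[cite: KellerYin2024, §1.4 (arXiv:2402.12781v2 TeX L1063–1098)] [cite: GreenbergLNM1716, §4 p. 109] -/
theorem exists_stableLine_hZero_package_of_anomalousTwist {V : WeierstrassCurve ℚ} [V.IsElliptic] [V.IsGloballyMinimal]
    (W : WeierstrassCurve ℚ) [W.IsElliptic] (p : ℕ) [Fact p.Prime]
    (hp3 : p = 3) (hV : GoodOrd V p) (ha : (p : ℤ) ∣ V.frobeniusTrace p - 1)
    (C : VariableChange ℚ) (hC : C • V.quadraticTwist ((-1 : ℚ) ^ (p / 2) * p) = W)
    (K : Type) [Field K] [NumberField K] (hK : IsImaginaryQuadratic K)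
    (htor : ∀ Q : (W.baseChange K).toAffine.Point, p • Q = 0 → Q = 0)
    {v : HeightOneSpectrum (𝓞 K)} (vbar : HeightOneSpectrum (𝓞 K)) (hpvK : ((p : ℕ) : 𝓞 K) ∈ v.asIdeal)
    (hvbar : ((p : ℕ) : 𝓞 K) ∈ vbar.asIdeal) (hne : vbar ≠ v)
    (κ : ZpExtension K p)
    (θsub θquot : FramedGaloisRep K (padicCoeffIntegers (∅ : Set (PadicAlgCl p))) 1)
    (hpair : IsResidualPairOver (W.baseChange K) p θsub θquot)
    (hram : ∃ τ ∈ decomp vbar, unitChar θsub τ ≠ 1)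
    (hfinED : Finite {x : ↥((W.baseChange K).geomPrimaryTorsion p) // ∀ g : ↥(κ.kerSubgroup ⊓ decomp vbar), g • x = x}) :
    ∃ (Φ : StableSubgroup (absoluteGaloisGroup K) ↥((W.baseChange K).geomTorsion (p : ℤ)))
      (j₁ : Φ.Sub →+ charModule ∅ θsub) (j₃ : Φ.Quot →+ charModule ∅ θquot),
      (∀ (g : absoluteGaloisGroup K) (a : Φ.Sub), j₁ (g • a) = g • j₁ a) ∧
      (∀ (g : absoluteGaloisGroup K) (a : Φ.Quot), j₃ (g • a) = g • j₃ a) ∧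
      Function.Injective j₁ ∧ Function.Injective j₃ ∧
      (∀ x : charModule ∅ θsub, x ∈ j₁.range ↔ p • x = 0) ∧ (∀ x : charModule ∅ θquot, x ∈ j₃.range ↔ p • x = 0) ∧
      Nat.card Φ.Sub = p ∧
      (∀ x : (charModule ∅ θsub), (∀ g : ↥κ.kerSubgroup, g • x = x) → ∃ x' : (charModule ∅ θsub), (∀ g : ↥κ.kerSubgroup, g • x' = x') ∧ p • x' = x) ∧
      (∀ x : ↥((W.baseChange K).geomPrimaryTorsion p), (∀ g : ↥κ.kerSubgroup, g • x = x) → ∃ x' : ↥((W.baseChange K).geomPrimaryTorsion p), (∀ g : ↥κ.kerSubgroup, g • x' = x') ∧ p • x' = x) ∧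
      (∀ x : (charModule ∅ θquot), (∀ g : ↥κ.kerSubgroup, g • x = x) → ∃ x' : (charModule ∅ θquot), (∀ g : ↥κ.kerSubgroup, g • x' = x') ∧ p • x' = x) ∧
      (∀ n : ↥((W.baseChange K).geomTorsion (p : ℤ)), (∀ g : ↥κ.kerSubgroup, g • n = n) → n = 0) ∧
      Finite {n : Φ.Quot // ∀ g : ↥κ.kerSubgroup, g • n = n} ∧
      Nat.card {n : Φ.Quot // ∀ g : ↥κ.kerSubgroup, g • n = n} = p ^ (if ∀ σ : absoluteGaloisGroup K, θquot σ = 1 then 1 else 0) ∧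
      (∀ n : Φ.Sub, (∀ g : ↥(κ.kerSubgroup ⊓ decomp vbar), g • n = n) → n = 0) ∧
      (∀ (g : ↥(κ.kerSubgroup ⊓ decomp vbar)) (n : Φ.Quot), g • n = n) ∧
      Finite Φ.Quot ∧ Nat.card Φ.Quot = p ∧
      Finite {x : ↥((W.baseChange K).geomPrimaryTorsion p) // ∀ g : ↥(κ.kerSubgroup ⊓ decomp vbar), g • x = x} ∧
      (∀ x : (charModule ∅ θsub), (∀ g : ↥(κ.kerSubgroup ⊓ decomp vbar), g • x = x) → ∃ x' : (charModule ∅ θsub), (∀ g : ↥(κ.kerSubgroup ⊓ decomp vbar), g • x' = x') ∧ p • x' = x) ∧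
      (∀ x : (charModule ∅ θquot), (∀ g : ↥(κ.kerSubgroup ⊓ decomp vbar), g • x = x) → ∃ x' : (charModule ∅ θquot), (∀ g : ↥(κ.kerSubgroup ⊓ decomp vbar), g • x' = x') ∧ p • x' = x) := by
  haveI hEK : (W.baseChange K).IsElliptic := inferInstanceAs (W.map (algebraMap ℚ K)).IsElliptic
  obtain ⟨Φ, hSub, hQuot, ⟨j₁, hj₁, hj₁inj, hr₁⟩, ⟨j₃, hj₃, hj₃inj, hr₃⟩⟩ :=
    ResidualPairStableLine.exists_stableLine_of_isResidualPairOver (W.baseChange K) hpair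
  exact ⟨Φ, j₁, j₃, hj₁, hj₃, hj₁inj, hj₃inj, hr₁, hr₃, hSub, hZero_package_of_anomalousTwist W p hp3 hV ha C hC K hK htor vbar hpvK
    hvbar hne κ θsub θquot hpair hram hfinED Φ hSub hQuot j₁ hj₁ hj₁inj j₃ hj₃ hj₃inj⟩

end Package

end Summit.BirchSwinnertonDyer.BirchSwinnertonDyer.Theorems.SchneiderFreeAdditiveX3.AnomalousTwistLocalHZero

end
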